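import Summits.HodgeConjecture.HodgeConjecture.Theorems.Ring2AbelianAllStandardBKunnethProjectors
import HarnessLib

/-!
# The tree's degree-wise `B⋆(X, η)` is Grothendieck–Kleiman–André's `B(X)` in its printed, junk-free form:
# each `*_L|Hᵃ` is induced by ONE algebraic class acting as zero on every other degree
# (cell `hodge-nonav`, INDEX rows S18 ∕ SQ2 «mod B(X)»; kernel, 0 definitions, 0 named facts)

PROVENANCE. Cell hodge-nonav (HUMAN RULING D-0038), planner p1 g35 ask 2026-08-28T06:44:40Z («land the three-line
corollary as a NAMED theorem so every «mod B» row can cite it»); seat `littype-FH1-2` (literature-prover, g19).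
SUPPORT FILE (`--supports stmt-HodgeConjecture-19654 --as helper`). CONDITIONAL results only: the open standard
conjecture `B⋆(X, η)` (`Literature.AlgebraicGeometry.HodgeTheory.StandardConjectureBStar`) occurs as a HYPOTHESIS or as one
side of an equivalence; nothing here proves a case of the Hodge conjecture; rung F-H1 is not moved.

## Print status (pages read 2026-08-28; held texts)

* André 1996, *Pour une théorie inconditionnelle des motifs*, Publ. IHÉS 83, §0.2 (held text p0004 L23–27), verbatim:
  «l'involution « de Lefschetz » `*_L`, donnée en chaque degré par l'isomorphisme de Lefschetz ou son inverse (§ 1), doit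
  être un morphisme de cette catégorie. Faute de savoir en général si `*_L` est donnée par une correspondance algébrique,
  l'idée clé de cet article est d'adjoindre formellement cette involution aux correspondances algébriques»; Appendix
  (p0041 L16–20): «Notons B la conjecture standard de Grothendieck suivante : l'involution de Lefschetz est donnée par une
  correspondance algébrique (ceci ne dépend pas du choix de la polarisation de X, cf. [Kl68]). Les implications
  N ⇒ B ⇒ G sont dues à Grothendieck [G69]», with G ⟺ «l'algébricité des projecteurs de Künneth `π_X^j`».
* Kleiman 1968 Prop. 2.3 as quoted by Ramón Marí 2007 (arXiv:math/0703005, held text p0002 L51, p0004 Prop. 2.5 (ii)):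
  «B(X): The operator `Λ` is induced by an algebraic cycle; equivalently ([Kleiman] Prop. 2.3), all the operators in the
  `sl₂`-triple (`ᶜΛ, L, H`) are algebraic»; «B(X) holds if and only if, for all `i < n`, the inverse
  `θⁱ : H^{2n−i}(X) → Hⁱ(X)` to the Lefschetz isomorphism `L^{n−i}` is induced by an algebraic correspondence for `i < n`».

PRINT-B (the GRADED involution `*_L` on `H•(X)` is induced by an element of the ring of algebraic correspondences) forces,
degree by degree, ONE homogeneous algebraic class `u_a` (codimension `b = 2n − a`) acting as `*_L` on `Hᵃ` and as `0` on
every `Hᵃ'`, `a' ≠ a` ("junk-free"). The tree's `StandardConjectureBStar n X η` asks only for SOME algebraic class inducing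
`*_L : Hᵃ → H^{2n−a}` in each degree, its action on the other degrees uncontrolled — formally the WEAKER hypothesis. This
file records that over `ℂ` the two agree, because the tree PROVES Kleiman's `B ⟹ C` from the degree-wise form
(`Ring2.AbelianAll.exists_kunnethProjector_of_standardConjectureBStar`: ONE algebraic Künneth projector `π_a` per degree)
and has the class-level composition of correspondences (`Ring2.AbelianAll.exists_corrComp`): `u_a := S_a ∘ π_a` for any
algebraic `S_a` inducing `*_L|Hᵃ` (`Ring2.AbelianAll.IsAlgebraicCorrespondence.exists_eq_corrAction`).

## Content (all correspondence actions through `corrAction complexOrientationFamily`, the Ring2 currency)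

* `exists_junkFree_lefschetzInvolution_of_standardConjectureBStar` — **B⋆ ⟹ junk-free print-B, degree by degree**: for
  `a + b = 2n` ONE algebraic `u ∈ Nᵇ H²ᵇ((X ⊗ X)(ℂ); ℂ)` with `[u]_* = *_L` on `Hᵃ` and `[u]_* = 0` on `Hᵃ'` for all `a' ≠ a`
  (the codimension `b` is forced: `a + 2e = b + 2n ⟺ e = b`).
* `standardConjectureBStar_of_junkFree` — the converse (trivial: forget the vanishing clause;
  `isAlgebraicCorrespondence_corrAction` for the complex orientations).
* `standardConjectureBStar_iff_junkFree` — **`B⋆(X, η) ⟺ print-B(X, η)`** for a polarisation class `η`.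

0 `def`, 0 named fact, 0 `sorry`. References: Andre1996Motifs (§0.2 p. 7 of the journal = held p0004; §1.1; App. p. 41);
Kleiman1968AlgebraicCycles (§1.4, §2 Prop. 2.3, 2.4); Grothendieck1968 (§3); RamonMari2007Lefschetz (arXiv:math/0703005,
§1 p. 2, Prop. 2.5); Fulton1998 (§16.1 Prop. 16.1.1, for the composition).
-/

noncomputable section

set_option linter.dupNamespace false

namespace Summit.HodgeConjecture.HodgeConjecture.Theorems.LefschetzStandardPrintForm

open CategoryTheory AlgebraicGeometry MonoidalCategory CartesianMonoidalCategory
open Literature.AlgebraicGeometry Literature.AlgebraicGeometry.Motives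
open Literature.AlgebraicGeometry.HodgeTheory
open Summit.HodgeConjecture.HodgeConjecture.Ring2.AbelianAll

variable {n : ℕ} {X : SchemeOver ℂ} {η : complexBetti X 2}

/-- **`B⋆(X, η) ⟹` Grothendieck–Kleiman–André's `B(X)` in its printed, junk-free form, degree by degree.** For `X` smooth
projective over `ℂ` of dimension `n`, a polarisation class `η` with the tree's degree-wise `StandardConjectureBStar n X η`, and
`a + b = 2n`, there is ONE algebraic class `u ∈ Nᵇ H²ᵇ((X ⊗ X)(ℂ); ℂ)` whose correspondence action is André's Lefschetz
involution `*_L : Hᵃ(X(ℂ); ℂ) → Hᵇ(X(ℂ); ℂ)` on `Hᵃ` and ZERO on `Hᵃ'(X(ℂ); ℂ)` for every `a' ≠ a` («l'involution de Lefschetz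
est donnée par une correspondance algébrique», read exactly). Proof: `u = S ∘ π_a` with `S` any algebraic class inducing
`*_L|Hᵃ` (`B⋆`, normalised to the complex orientations) and `π_a` the ONE-class Künneth projector of
`exists_kunnethProjector_of_standardConjectureBStar` (Kleiman's `B ⟹ C`, proved in the tree from `B⋆`), composed at the
class level by `exists_corrComp` (Fulton Prop. 16.1.1). [cite: Andre1996Motifs, §0.2 (p. 7) and Appendix (p. 41)]
[cite: Kleiman1968AlgebraicCycles, §2 Prop. 2.3 and 2.4] [cite: Fulton1998, §16.1 Prop. 16.1.1] -/
theorem exists_junkFree_lefschetzInvolution_of_standardConjectureBStar (hX : IsSmoothProjective n X)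
    (hη : IsPolarizationClass n X η) (hB : StandardConjectureBStar n X η) {a b : ℕ} (hab : a + b = 2 * n) :
    ∃ u ∈ algebraicClasses (X ⊗ X) b,
      corrAction complexOrientationFamily hX hX (show a + 2 * b = b + 2 * n by omega) u =
          lefschetzInvolution hη.hasHardLefschetz hab ∧
        ∀ {a' b' : ℕ} (h' : a' + 2 * b = b' + 2 * n), a' ≠ a →
          corrAction complexOrientationFamily hX hX h' u = 0 := by
  -- `S`: some algebraic class inducing `*_L : Hᵃ → Hᵇ` for the complex orientations (degree-wise `B⋆`)
  obtain ⟨e, habS, S, hS, hSeq⟩ :=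
    IsAlgebraicCorrespondence.exists_eq_corrAction hX hX (hB hη a b hab)
  obtain rfl : e = b := by omega
  -- `π`: the ONE-class Künneth projector onto `Hᵃ` (Kleiman's `B ⟹ C` from `B⋆`, a tree theorem)
  obtain ⟨π, hπ, Hπ⟩ := exists_kunnethProjector_of_standardConjectureBStar hX hη hB a
  -- `u = S ∘ π`, composed at the class level (ONE class, every degree)
  obtain ⟨u, hu, Hu⟩ := exists_corrComp complexOrientationFamily hX hX hX (show e + n = e + n from rfl) hS hπ
  refine ⟨u, hu, ?_, fun {a' b'} h' ha' ↦ ?_⟩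
  · rw [Hu (rfl : a + 2 * n = a + 2 * n) habS (show a + 2 * e = e + 2 * n by omega), Hπ a, if_pos rfl, one_smul,
      LinearMap.comp_id, hSeq]
  · rw [Hu (rfl : a' + 2 * n = a' + 2 * n) h' h', Hπ a', if_neg ha', zero_smul, LinearMap.comp_zero]

/-- **The same for all degrees at once** (the printed graded statement, as a family `(u_a)_{a+b=2n}`): granted `B⋆(X, η)`,
for every `a + b = 2n` ONE algebraic class of codimension `b` acts as `*_L` on `Hᵃ` and as `0` on all other degrees.
[cite: Andre1996Motifs, §0.2 (p. 7) and Appendix (p. 41)] [cite: Kleiman1968AlgebraicCycles, §2 Prop. 2.3] -/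
theorem forall_exists_junkFree_lefschetzInvolution_of_standardConjectureBStar (hX : IsSmoothProjective n X)
    (hη : IsPolarizationClass n X η) (hB : StandardConjectureBStar n X η) :
    ∀ (a b : ℕ) (hab : a + b = 2 * n), ∃ u ∈ algebraicClasses (X ⊗ X) b,
      corrAction complexOrientationFamily hX hX (show a + 2 * b = b + 2 * n by omega) u =
          lefschetzInvolution hη.hasHardLefschetz hab ∧
        ∀ {a' b' : ℕ} (h' : a' + 2 * b = b' + 2 * n), a' ≠ a →
          corrAction complexOrientationFamily hX hX h' u = 0 :=
  fun _ _ hab ↦ exists_junkFree_lefschetzInvolution_of_standardConjectureBStar hX hη hB hab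

/-- **Print-B ⟹ B⋆** (the trivial direction): if in every degree `a + b = 2n` some algebraic class of codimension `b` induces
`*_L|Hᵃ` for the complex orientations (junk-freeness not even needed), then `StandardConjectureBStar n X η` — the action
of an algebraic class is an algebraic correspondence (`isAlgebraicCorrespondence_corrAction`).
[cite: Andre1996Motifs, §0.2–0.3 (pp. 7–8) and §2.1 (p. 14)] -/
theorem standardConjectureBStar_of_forall_exists (hX : IsSmoothProjective n X) (hη : IsPolarizationClass n X η)
    (h : ∀ (a b : ℕ) (hab : a + b = 2 * n), ∃ u ∈ algebraicClasses (X ⊗ X) b,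
      corrAction complexOrientationFamily hX hX (show a + 2 * b = b + 2 * n by omega) u =
        lefschetzInvolution hη.hasHardLefschetz hab) :
    StandardConjectureBStar n X η := by
  intro hη' a b hab
  obtain ⟨u, hu, hueq⟩ := h a b hab
  rw [← hueq]
  exact isAlgebraicCorrespondence_corrAction complexOrientationFamily hasPoincareDuality_complexOrientationFamily hX hX
    _ (show b + a = 2 * n by omega) hu

/-- **`B⋆(X, η) ⟺ B(X)` in its printed junk-free form**, for `X` smooth projective over `ℂ` of dimension `n` and a
polarisation class `η`: the tree's degree-wise `StandardConjectureBStar n X η` (SOME algebraic class inducing `*_L` in each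
degree, junk uncontrolled — André §0.2 «donnée en chaque degré») holds iff for every `a + b = 2n` ONE algebraic class of
codimension `b` induces `*_L` on `Hᵃ(X(ℂ); ℂ)` and `0` on every other degree (André, Appendix p. 41: «l'involution de
Lefschetz est donnée par une correspondance algébrique»; Kleiman 1968 Prop. 2.3). The non-trivial direction is Kleiman's
`B ⟹ C` run on the degree-wise form (`exists_kunnethProjector_of_standardConjectureBStar`) plus class-level composition.
[cite: Andre1996Motifs, §0.2 (p. 7) and Appendix (p. 41)] [cite: Kleiman1968AlgebraicCycles, §2 Prop. 2.3 and 2.4]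
[cite: Grothendieck1968, §3 p. 196 (B(X), C(X))] -/
theorem standardConjectureBStar_iff_junkFree (hX : IsSmoothProjective n X) (hη : IsPolarizationClass n X η) :
    StandardConjectureBStar n X η ↔
      ∀ (a b : ℕ) (hab : a + b = 2 * n), ∃ u ∈ algebraicClasses (X ⊗ X) b,
        corrAction complexOrientationFamily hX hX (show a + 2 * b = b + 2 * n by omega) u =
            lefschetzInvolution hη.hasHardLefschetz hab ∧
          ∀ {a' b' : ℕ} (h' : a' + 2 * b = b' + 2 * n), a' ≠ a →
            corrAction complexOrientationFamily hX hX h' u = 0 :=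
  ⟨fun hB ↦ forall_exists_junkFree_lefschetzInvolution_of_standardConjectureBStar hX hη hB,
    fun h ↦ standardConjectureBStar_of_forall_exists hX hη fun a b hab ↦
      let ⟨u, hu, hueq, _⟩ := h a b hab; ⟨u, hu, hueq⟩⟩

end Summit.HodgeConjecture.HodgeConjecture.Theorems.LefschetzStandardPrintForm

end
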